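import Literature.NumberTheory.GaloisRepresentations.IdeleTruncatedS
import HarnessLib

/-!
# The layers of `I_S`: `I_S^{Gal(K̄/E)} = J_{E,S}` for a layer `E ⊂ K_S` (Harari, *Galois Cohomology and CFT*,
# §17.4, Lemma 17.23: "`Ext^r_{G_S}(M, I_S) = lim→ Ext^r_{Gal(F/k)}(M, J_F^T)`", the finite-level reduction)

Topic `NumberTheory/GaloisRepresentations`; namespaces `Literature.NumberTheory.GaloisRepresentations.IdeleHerbrand` (§1)
and `Literature.NumberTheory.GaloisRepresentations.IdeleClassBar` (§2); a sequel to `IdeleTruncatedS.lean`.  Theorems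
only; NO named fact, no `sorry`, no instance, no notation; number fields in `Type`.

THE POINT.  The `S`-readout `Ext¹_{G_S}(M, I_S) ≅ P¹_S` is computed at a finite layer `E ⊂ K_S` through which the
finite-type module factors (Harari Lemma 17.23), which needs the LAYER FORMULA `I_S^{U_E} = J_{E,S}`: an element of
`I_S` fixed by `U_E = Gal(K̄/E)` is the class of a truncated idèle OF `E` (§2, `exists_mem_truncIdeles_of_forall_rep_eq`;
the converse is `IdeleClassBar.of_mem_truncIdeleBar` + `GalLayerSystem.rep_of_of_mem`).  The finite-level input (§1) is
that base change REFLECTS truncatedness: `x_{E'} ∈ J_{E',S} ⇒ x ∈ J_{E,S}` (every place of `E` has a place of `E'`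
above it and `E_w → E'_{w'}` is injective).

## What is formalised

* §1 `IdeleHerbrand.mem_truncIdeles_of_ideleBaseChange_mem` (`x_{E'} ∈ J_{E',S} → x ∈ J_{E,S}`),
  `ideleBaseChange_mem_truncIdeles_iff`.
* §2 **`IdeleClassBar.exists_mem_truncIdeles_of_forall_rep_eq`**: for `E ⊂ K_S` and `z ∈ I_S` with `σ • z = z` for all
  `σ ∈ U_E`, `∃ x ∈ J_{E,S}, [x]_E = z`; `mem_truncIdeles_of_of_mem_truncIdeleBar` (`[x]_E ∈ I_S`, `E ⊂ K_S` ⇒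
  `x ∈ J_{E,S}`).

Written for lane «PT-Ш-S-TC» (brick D3) of crux `GoodLatticeBDPValue` (cell bsd-eis, item 19032), seat bsd-line-x1-p1-w6
gen 10.  HONEST FRAMING: bookkeeping; no arithmetic statement and no case of BSD is proved here.

## References
* D. Harari, *Galois Cohomology and Class Field Theory*, Universitext, Springer (2020), §17.4 (17.1), Def. 17.22,
  Lemma 17.23. [Harari2020]
* J. W. S. Cassels, A. Fröhlich (eds.), *Algebraic Number Theory* (1967), Ch. VII (J. Tate) §8 Prop. 8.1. [CasselsFrohlichANT1967]
-/

noncomputable section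

open NumberField IsDedekindDomain
open Field (absoluteGaloisGroup)
open Literature.NumberTheory.Automorphic
open scoped Classical

namespace Literature.NumberTheory.GaloisRepresentations

/-! ## §1. Base change reflects truncatedness -/

namespace IdeleHerbrand

variable {F : Type} [Field F] [NumberField F] {E : Type} [Field E] [NumberField E] [Algebra F E]
variable {E' : Type} [Field E'] [NumberField E'] [Algebra E E'] [Algebra F E'] [IsScalarTower F E E']

omit [NumberField F] in
/-- **`x_{E'} ∈ J_{E',S} ⇒ x ∈ J_{E,S}`**: for `w ∤ S` a place of `E` pick `w' ∣ w` of `E'`; then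
`ι(x_w) = (x_{E'})_{w'} = 1` and `ι : E_w → E'_{w'}` is injective. [cite: Harari2020, §17.4, Lemma 17.23 (proof)]
[cite: CasselsFrohlichANT1967, Ch. VII §8 Prop. 8.1] -/
theorem mem_truncIdeles_of_ideleBaseChange_mem (S : Finset (HeightOneSpectrum (𝓞 F))) {x : ideleGroup E}
    (hx : AdeleRing.ideleBaseChange E E' x ∈ truncIdeles F E' S) : x ∈ truncIdeles F E S := fun w hw => by
  obtain ⟨w', rfl⟩ : ∃ w' : HeightOneSpectrum (𝓞 E'), w'.under (𝓞 E) = w :=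
    HeightOneSpectrum.under_surjective w
  haveI : w'.asIdeal.LiesOver (w'.under (𝓞 E)).asIdeal := ⟨rfl⟩
  have hw' : w'.under (𝓞 F) ∉ S := by rwa [HeightOneSpectrum.under_under F E E' w'] at hw
  have h := hx w' hw'
  rw [AdeleRing.coe_ideleBaseChange, AdeleRing.baseChange_snd, FiniteAdeleRing.baseChange_apply,
    adicCompletionOfUnder_eq E w' rfl] at h
  exact (map_eq_one_iff _ (RingHom.injective _)).1 h

omit [NumberField F] in
/-- **`x_{E'} ∈ J_{E',S} ↔ x ∈ J_{E,S}`.** [cite: Harari2020, §17.4, Lemma 17.23 (proof)] -/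
theorem ideleBaseChange_mem_truncIdeles_iff (S : Finset (HeightOneSpectrum (𝓞 F))) {x : ideleGroup E} :
    AdeleRing.ideleBaseChange E E' x ∈ truncIdeles F E' S ↔ x ∈ truncIdeles F E S :=
  ⟨mem_truncIdeles_of_ideleBaseChange_mem S, ideleBaseChange_mem_truncIdeles S⟩

end IdeleHerbrand

/-! ## §2. The layer formula `I_S^{U_E} = J_{E,S}` -/

namespace IdeleClassBar

variable {K : Type} [Field K] [NumberField K] {S : Finset (HeightOneSpectrum (𝓞 K))}

/-- **If `[x]_E ∈ I_S` then `x ∈ J_{E,S}`** (any layer `E`): `[x]_E = [y]_M` with `y ∈ J_{M,S}`; in the common layer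
`E ⊔ M` the base changes agree (`of_injective`), and base change reflects truncatedness.
[cite: Harari2020, §17.4, Lemma 17.23 (proof)] -/
theorem mem_truncIdeles_of_of_mem_truncIdeleBar (E : GalLayer K) {x : (ideleData K).V E}
    (hx : (ideleData K).toSystem.of E x ∈ truncIdeleBar K S) :
    haveI := E.numberField; (Additive.toMul x : ideleGroup E.1) ∈ IdeleHerbrand.truncIdeles K E.1 S := by
  obtain ⟨M, -, y, hy, hxy⟩ := mem_truncIdeleBar_iff.1 hx
  haveI := E.numberField
  haveI := M.numberField
  haveI := (GalLayer.sup E M).numberField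
  have hE : E ≤ GalLayer.sup E M := le_sup_left (a := E.1) (b := M.1)
  have hM : M ≤ GalLayer.sup E M := le_sup_right (a := E.1) (b := M.1)
  letI := GalLayer.algebraOfLE hE
  letI := GalLayer.algebraOfLE hM
  haveI := GalLayer.isScalarTower_of_le hE
  haveI := GalLayer.isScalarTower_of_le hM
  have hbase : (ideleData K).base hE x = (ideleData K).base hM y :=
    (ideleData K).toSystem.of_injective (GalLayer.sup E M)
      (by rw [(ideleData K).toSystem.of_base hE, (ideleData K).toSystem.of_base hM, hxy])
  have hy' : (Additive.toMul ((ideleData K).base hM y) : ideleGroup (GalLayer.sup E M).1) ∈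
      IdeleHerbrand.truncIdeles K (GalLayer.sup E M).1 S := by
    rw [toMul_ideleData_base]; exact IdeleHerbrand.ideleBaseChange_mem_truncIdeles S hy
  rw [← hbase, toMul_ideleData_base] at hy'
  exact IdeleHerbrand.mem_truncIdeles_of_ideleBaseChange_mem S hy'

/-- **The layer formula `I_S^{U_E} = J_{E,S}`**: an element of `I_S` fixed by `U_E = Gal(K̄/E)` is the class of a
truncated idèle of `E` (Galois descent in `J̄`, then `mem_truncIdeles_of_of_mem_truncIdeleBar`).  No hypothesis
`E ⊂ K_S` is needed for this direction; for `E ⊂ K_S` the converse is `of_mem_truncIdeleBar` with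
`GalLayerSystem.rep_of_of_mem`. [cite: Harari2020, §17.4, Lemma 17.23] [cite: CasselsFrohlichANT1967, Ch. VII §8 Prop. 8.1] -/
theorem exists_mem_truncIdeles_of_forall_rep_eq (E : GalLayer K) {z : (ideleData K).toSystem.limit}
    (hz : z ∈ truncIdeleBar K S) (hfix : ∀ σ ∈ E.openNormalSubgroup, (ideleData K).toSystem.rep σ z = z) :
    ∃ x : (ideleData K).V E, (haveI := E.numberField; (Additive.toMul x : ideleGroup E.1) ∈
      IdeleHerbrand.truncIdeles K E.1 S) ∧ (ideleData K).toSystem.of E x = z := by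
  obtain ⟨x, rfl⟩ := (ideleData K).toSystem.exists_of_eq_of_forall_mem E z hfix
  exact ⟨x, mem_truncIdeles_of_of_mem_truncIdeleBar E hz, rfl⟩

end IdeleClassBar

end Literature.NumberTheory.GaloisRepresentations

end
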